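import Summits.SmoothPoincare4.SmoothPoincare4.Theses.SymplecticOrigami

/-!
# SmoothPoincare4 / SymplecticOrigami — assembly

Settles item stmt-SmoothPoincare4-7846 (assembly of route SymplecticOrigami):
`OrigamiRung → NoGenusTwoDoor → OrigamiFoldExistence → SmoothPoincare4`.

Pure logic, mirroring the route's gate-checked `closes` theorem: `SmoothPoincare4` unfolds to
"every Hausdorff second-countable smooth (ℝ⁴-charted, C^∞) 4-manifold `M` homotopy equivalent to
`S⁴` is diffeomorphic to `S⁴`". For such an `M`, `OrigamiFoldExistence` (E) supplies the Fin 2-indexed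
fold data (pieces `V i`, closed symplectic `(N i, s i)`, symplectic surfaces `b i`, blow-down maps
`β i`); `OrigamiRung` (R) applied to these data returns either `Nonempty (M ≃ₘ S⁴)` — done — or that
every `N i` is a door (`rank H₁ = 2 ∧ rank H₂ = 1`); in the latter case `NoGenusTwoDoor` (D) applied
to the closed symplectic manifold `(N 0, s 0)` refutes the door at `i = 0`. No named fact and no
packaging lemma (compactness / orientability of homotopy spheres) is used.
-/

namespace Summit.SmoothPoincare4.SmoothPoincare4.Theorems

open Summit.SmoothPoincare4.SmoothPoincare4.Theses.SymplecticOrigami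

/-- Settles stmt-SmoothPoincare4-7846: the assembly
`OrigamiRung → NoGenusTwoDoor → OrigamiFoldExistence → SmoothPoincare4` of route SymplecticOrigami.
Proof: unfold the problem statement, take a homotopy 4-sphere `M`, get the fold data from
`OrigamiFoldExistence`, feed them to `OrigamiRung`, and in the door branch contradict
`NoGenusTwoDoor` at the piece `N 0`. [folklore] -/
theorem symplecticOrigamiAssembly_proof :
    Summit.SmoothPoincare4.SmoothPoincare4.Theses.SymplecticOrigami.Assembly := by
  unfold Assembly
  intro hR hD hE
  unfold _root_.SmoothPoincare4 Literature.SPC4.SmoothPoincareConjectureFour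
    ContinuousMap.HomotopyEquiv.NonemptyDiffeomorphSphere
  intro M _ _ _ _ _ e
  obtain ⟨V, N, _, _, _, _, _, _, _, s, S, _, _, _, _, _, b, β, hdata, hprops⟩ := hE M e
  rcases hR M e V N s S b β hdata hprops with h | h
  · exact h
  · exact absurd (h 0) (hD (N 0) (s 0) (hprops 0).1 (hprops 0).2.1 (hprops 0).2.2.1)

end Summit.SmoothPoincare4.SmoothPoincare4.Theorems
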